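import Literature.Probability.RandomPlanarGeometry.HexSAWSurfaceWallRenewalSixStep
import Literature.Probability.RandomPlanarGeometry.HexSAWHammersleyWelshExplicit
import HarnessLib

/-!
# The adsorbed renewal structure of honeycomb wall bridges down to `y > μ³ = (2+√2)^{3/2}`

Topic `Literature/Probability/RandomPlanarGeometry` (lane «pcv-sawmu», a-p6 g19, car «RENEWAL-CUBE-RANGE»; parents:
`HexSAWSurfaceWallRenewal.lean` (a-idea-1 g28: positive wall bridges `pwb`, irreducible pieces `ipwb`, the weighted renewal
equation `P_{2s} = Σ Λ_{2k} P_{2s−2k}`, the renewal pair `u_s = pwbAmp y s = P_{2s}/β^{2s}`, `f_s = pwbLaw y s = Λ_{2s}/β^{2s}`,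
the mean `m(y) = pwbMean y`, and — for `y > μ⁴` — the Kesten relation `hasSum_pwbLaw`, `summable_mul_pwbLaw`, the renewal theorem
`tendsto_pwbAmp` and its corollaries) and `HexSAWSurfaceWallRenewalSixStep.lean` (a-idea-1 g33: the SIX-STEP LAW
`six_mul_visits_le : 6·visits ≤ n` on `ipwb n`, `n ≥ 4`, and its envelope `pwbLaw_le_pow_div_pow_sub :
f_s(y) ≤ μ^{2s+2}/y^{s−⌊s/3⌋}`, `s ≥ 2`, `y ≥ 1`); the model-free renewal toolkit `Process/Renewal{GeometricEnvelope,Theorem,Rate}.lean`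
[Feller1968, XIII.3 and Ch. XIII §11] and `Zd.renewal_two_sub_tsum_le` (`SAWPulledRenewalGap.lean`)).

THE POINT.  Everything in §5–§6 of `HexSAWSurfaceWallRenewal.lean` rests on ONE input, a geometric envelope `f_s ≤ C θ^s` with
`θ < 1`, plus the exponential growth of `u_s ρ^s` (`pwbAmp_mul_pow_unbounded`, valid for every `y > 0`).  There the envelope
comes from the entropy lemma `4·visits ≤ n + 2`, giving `θ(y) = μ²/√y`, `< 1` iff `y > μ⁴ = (2+√2)² = 6 + 4√2 ≈ 11.66`.  The
six-step law `6·visits ≤ n` improves the per-block weight from `(√y)^{s+1}` to `y^{⌊s/3⌋}`, hence the envelope ratio to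
`θ₃(y) := μ²/y^{2/3}` (written out, no new definition), `< 1` iff `y > μ³ = (2+√2)^{3/2} ≈ 6.31` (§1: `theta_cube_lt_one`,
`mu_cube_lt_of_theta_cube_lt_one`).
Feeding `pwbLaw_le_geom_cube : f_s(y) ≤ (μ² + y^{2/3}/μ²) θ₃(y)^s` (all `s`, `y ≥ 1`) to the same toolkit gives, VERBATIM in
form and now for every `y > μ³`:
* §2 ★★ `hasSum_pwbLaw_of_cube_lt : Σ_s Λ_{2s}(y) β(y)^{−2s} = 1` — the KESTEN RELATION of the adsorbed phase
  [MadrasSlade1993, §4.2, eq. (4.2.4) (p. 91); Kesten1963SAW, §4]; `summable_mul_pwbLaw_of_cube_lt : m(y) < ∞`;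
  ★★ `tendsto_pwbAmp_of_cube_lt : P_{2s}(y)/β(y)^{2s} → 1/m(y)` — the RENEWAL THEOREM [MadrasSlade1993, §4.2, Theorem 4.2.2(b)
  (pp. 91–92); Feller1968, XIII.3, Theorem 3]: positive wall bridges of the adsorbed phase grow PURELY exponentially;
  `one_le_pwbMean_of_cube_lt`, `pwbMean_pos_of_cube_lt`, `PWB_two_sided_of_cube_lt : (2 − m) β^{2s} ≤ P_{2s} ≤ β^{2s}` and
  `two_sub_pwbMean_mul_pow_le_WB_of_cube_lt` for ALL `s`, the explicit geometric rate `abs_pwbAmp_sub_inv_pwbMean_le_of_cube_lt`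
  (in `_of` form), `eventually_mul_pow_le_WB_of_lt_inv_pwbMean_of_cube_lt`, the ratio limit `tendsto_PWB_ratio_of_cube_lt :
  P_{2s+2}/P_{2s} → β(y)²`, and the explicit mean bound `pwbMean_le_of_cube_lt : m(y) ≤ 1 + (μ² + y^{2/3}/μ²) θ₃²/(1−θ₃)²`.

HONEST LABEL.  LANE THEOREM (range extension, DERIVED): the renewal structure of Kesten / Madras–Slade §4.2 for SURFACE-WEIGHTED
wall bridges of the honeycomb half-lattice, which the tree had on `y > μ⁴`, holds on `y > μ³`; the new ingredient is the
six-step law of `HexSAWSurfaceWallRenewalSixStep.lean` (the lane's «six steps per visit» theorem), the rest is the tree's toolkit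
applied to the sharper envelope.  NEW IN WRITING (modest): the adsorbed Kesten relation, finite mean block length and pure
exponential order of positive-wall-bridge partition functions on the explicit range `y > (2+√2)^{3/2}`; print has the renewal
structure for unweighted bridges [MadrasSlade1993, §4.2; Kesten1963SAW, §4] and, for honeycomb bridges at `y = 1`,
[BeatonBousquetMelouDeGierDuminilCopinGuttmann2014, Appendix (proof of Theorem 10)]; the surface-weighted version and any explicit
fugacity range are the lane's.  Sources of the ingredients AS PRINTED: bridges, irreducible bridges, the renewal equation and the
renewal theorem [MadrasSlade1993, Definition 1.2.4 (p. 11), §4.2, Definition 4.2.1, eqs. (4.2.2), (4.2.4), (4.2.5), Theorem 4.2.2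
(pp. 90–92)], the span/length remark for irreducible bridges [MadrasSlade1993, §4.2, remark before (4.2.21) (p. 94)],
[Kesten1963SAW, §4], [Feller1968, XIII.3 and Ch. XIII §11]; surface bridges [HammersleyTorrieWhittington1982, §2]; the
surface-visit weights of the honeycomb half-lattice [BeatonBousquetMelouDeGierDuminilCopinGuttmann2014, §3.1 (arXiv v5 pp. 8–9)];
`μ(ℍ) = √(2+√2)` [DuminilCopinSmirnov2012, Theorem 1] enters only through the symbol `hexConnectiveConstant`.  NOT claimed:
anything for `y ≤ μ³` (in particular near `y_c = 1 + √2 ≈ 2.41`, where `θ₃ ≥ 1` and recurrence of the wall-renewal process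
stays open here), `m(y) < 2` on the new range (the explicit bound gives it only where `(μ² + y^{2/3}/μ²) θ₃² < (1−θ₃)²`), a
renewal theorem for ALL wall bridges `WB`, numerics.  No definitions (the file is def-free).
-/

noncomputable section

open Finset Filter Function
open Literature.Probability.LatticeModels Literature.Probability.Percolation SimpleGraph
open Literature.Combinatorics.Enumerative
open _root_.Topology

namespace Literature.Probability.RandomPlanarGeometry.SAW.HexBW.Wall

variable {y : ℝ}

/-! ### §1 The geometric envelope of ratio `θ₃(y) = μ² / y^{2/3}` -/

/-- [folklore] `θ₃(y) = μ²/y^{2/3} > 0` for `y > 0`. -/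
private theorem theta_cube_pos (hy : 0 < y) : 0 < hexConnectiveConstant ^ 2 / y ^ ((2 : ℝ) / 3) :=
  div_pos (pow_pos hexConnectiveConstant_pos 2) (Real.rpow_pos_of_pos hy _)

/-- [folklore] `(μ³)^{2/3} = μ²`. -/
private theorem mu_cube_rpow_cr : (hexConnectiveConstant ^ 3) ^ ((2 : ℝ) / 3) = hexConnectiveConstant ^ 2 := by
  have hμ := hexConnectiveConstant_pos
  rw [← Real.rpow_natCast hexConnectiveConstant 3, ← Real.rpow_mul hμ.le]
  norm_num

/-- **The threshold**: `θ₃(y) < 1` iff `y > μ³`; here the direction used: `μ³ < y ⇒ θ₃(y) < 1`.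
[cite: MadrasSlade1993, §4.2, remark before (4.2.21) (p. 94)] -/
theorem theta_cube_lt_one (hy : hexConnectiveConstant ^ 3 < y) : hexConnectiveConstant ^ 2 / y ^ ((2 : ℝ) / 3) < 1 := by
  have hμ := hexConnectiveConstant_pos
  have hμ3 : 0 < hexConnectiveConstant ^ 3 := pow_pos hμ 3
  have hy0 : 0 < y := hμ3.trans hy
  have hlt : hexConnectiveConstant ^ 2 < y ^ ((2 : ℝ) / 3) := by
    rw [← mu_cube_rpow_cr]
    exact Real.rpow_lt_rpow hμ3.le hy (by norm_num)
  exact (div_lt_one (Real.rpow_pos_of_pos hy0 _)).2 hlt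

/-- Conversely `θ₃(y) < 1 ⇒ μ³ < y` (`y > 0`): the threshold is exactly `μ³ = (2+√2)^{3/2}`. [cite: MadrasSlade1993, §4.2] -/
theorem mu_cube_lt_of_theta_cube_lt_one (hy : 0 < y) (h : hexConnectiveConstant ^ 2 / y ^ ((2 : ℝ) / 3) < 1) :
    hexConnectiveConstant ^ 3 < y := by
  have hμ := hexConnectiveConstant_pos
  have hμ3 : 0 < hexConnectiveConstant ^ 3 := pow_pos hμ 3
  have hlt : hexConnectiveConstant ^ 2 < y ^ ((2 : ℝ) / 3) := by
    rwa [div_lt_one (Real.rpow_pos_of_pos hy _)] at h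
  rw [← mu_cube_rpow_cr] at hlt
  by_contra hle
  exact absurd hlt (not_lt.2 (Real.rpow_le_rpow hy.le (not_lt.1 hle) (by norm_num)))

/-- [folklore] `μ³ < y` forces `1 ≤ y` (`μ ≥ 1`). -/
private theorem one_le_of_mu_cube_lt (hy : hexConnectiveConstant ^ 3 < y) : 1 ≤ y :=
  (one_le_pow₀ one_le_hexConnectiveConstant).trans hy.le

/-- [folklore] The exponent bookkeeping of the six-step envelope: `(y^{2/3})^s ≤ y^{s − ⌊s/3⌋}` for `y ≥ 1`
(`⌊s/3⌋ ≤ s/3`). -/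
private theorem rpow_two_thirds_pow_le (hy : 1 ≤ y) (s : ℕ) : (y ^ ((2 : ℝ) / 3)) ^ s ≤ y ^ (s - s / 3) := by
  have hy0 : 0 ≤ y := by linarith
  rw [← Real.rpow_natCast (y ^ ((2 : ℝ) / 3)) s, ← Real.rpow_mul hy0, ← Real.rpow_natCast y (s - s / 3)]
  refine Real.rpow_le_rpow_of_exponent_le hy ?_
  have h1 : ((s / 3 : ℕ) : ℝ) ≤ (s : ℝ) / 3 := Nat.cast_div_le
  have h2 : ((s - s / 3 : ℕ) : ℝ) = (s : ℝ) - ((s / 3 : ℕ) : ℝ) := by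
    rw [Nat.cast_sub (Nat.div_le_self s 3)]
  rw [h2]
  linarith

/-- **Geometric envelope of the renewal law with ratio `θ₃`**: for `y ≥ 1` and every `s`,
`f_s(y) ≤ (μ² + y^{2/3}/μ²) · θ₃(y)^s` — from the six-step envelope `f_s ≤ μ^{2s+2}/y^{s−⌊s/3⌋}` (`s ≥ 2`),
`f_1 = y/β(y)² ≤ 1` and `f_0 = 0`. [cite: MadrasSlade1993, §4.2, remark before (4.2.21) (p. 94)] [cite: Feller1968, XIII.3] -/
theorem pwbLaw_le_geom_cube (hy : 1 ≤ y) (s : ℕ) :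
    pwbLaw y s ≤ (hexConnectiveConstant ^ 2 + y ^ ((2 : ℝ) / 3) / hexConnectiveConstant ^ 2) *
      (hexConnectiveConstant ^ 2 / y ^ ((2 : ℝ) / 3)) ^ s := by
  have hy0 : 0 < y := by linarith
  have hμ := hexConnectiveConstant_pos
  have hμ2 : 0 < hexConnectiveConstant ^ 2 := pow_pos hμ 2
  have hr0 : 0 < y ^ ((2 : ℝ) / 3) := Real.rpow_pos_of_pos hy0 _
  set θ := hexConnectiveConstant ^ 2 / y ^ ((2 : ℝ) / 3) with hθ
  set C := hexConnectiveConstant ^ 2 + y ^ ((2 : ℝ) / 3) / hexConnectiveConstant ^ 2 with hC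
  have hθ0 : 0 < θ := theta_cube_pos hy0
  have hC1 : hexConnectiveConstant ^ 2 ≤ C := le_add_of_nonneg_right (div_nonneg hr0.le hμ2.le)
  rcases Nat.lt_or_ge s 2 with hs | hs
  · interval_cases s
    · rw [pwbLaw_zero]; positivity
    · -- `f_1 ≤ u_1 ≤ 1 = (y^{2/3}/μ²) · θ₃ ≤ C θ₃`
      have h1 : pwbLaw y 1 ≤ 1 := (pwbLaw_le_pwbAmp hy0.le 1).trans (pwbAmp_le_one hy0 1)
      have h2 : y ^ ((2 : ℝ) / 3) / hexConnectiveConstant ^ 2 * θ ^ 1 = 1 := by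
        rw [pow_one, hθ]; field_simp
      calc pwbLaw y 1 ≤ y ^ ((2 : ℝ) / 3) / hexConnectiveConstant ^ 2 * θ ^ 1 := by rw [h2]; exact h1
        _ ≤ C * θ ^ 1 := mul_le_mul_of_nonneg_right (le_add_of_nonneg_left hμ2.le) (pow_nonneg hθ0.le _)
  · have henv := pwbLaw_le_pow_div_pow_sub hy hs
    have hkey : hexConnectiveConstant ^ (2 * s + 2) / y ^ (s - s / 3) ≤ hexConnectiveConstant ^ 2 * θ ^ s := by
      rw [hθ, div_pow, ← pow_mul, show hexConnectiveConstant ^ (2 * s + 2) =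
        hexConnectiveConstant ^ 2 * hexConnectiveConstant ^ (2 * s) by ring, mul_div_assoc]
      refine mul_le_mul_of_nonneg_left ?_ hμ2.le
      exact div_le_div_of_nonneg_left (pow_nonneg hμ.le _) (pow_pos hr0 s) (rpow_two_thirds_pow_le hy s)
    exact henv.trans (hkey.trans (mul_le_mul_of_nonneg_right hC1 (pow_nonneg hθ0.le _)))

/-! ### §2 The adsorbed Kesten relation, finite mean and the renewal theorem for `y > μ³` -/

/-- **The Kesten relation of the adsorbed phase down to `y > μ³ = (2+√2)^{3/2} ≈ 6.31`**: `Σ_s Λ_{2s}(y) β(y)^{−2s} = 1`.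
The tree's `hasSum_pwbLaw` needs `y > μ⁴ ≈ 11.66` (envelope ratio `μ²/√y` from `4·visits ≤ n + 2`); the six-step law
gives the ratio `μ²/y^{2/3}`. NEW (range extension).
[cite: MadrasSlade1993, §4.2, eq. (4.2.4) (p. 91) and Theorem 4.2.2(b) (pp. 91–92)] [cite: Kesten1963SAW, §4]
[cite: Feller1968, XIII.3, Theorem 2 (persistence)] -/
theorem hasSum_pwbLaw_of_cube_lt (hy : hexConnectiveConstant ^ 3 < y) : HasSum (pwbLaw y) 1 := by
  have hy1 := one_le_of_mu_cube_lt hy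
  have hy0 : 0 < y := by linarith
  exact Literature.Probability.Process.Renewal.hasSum_f_one_of_envelope (u := pwbAmp y) (f := pwbLaw y) pwbAmp_zero
    (pwbAmp_nonneg hy0.le) (pwbAmp_le_one hy0) (pwbLaw_nonneg hy0.le) pwbLaw_zero (fun n hn => pwbAmp_eq_sum hn)
    (theta_cube_pos hy0) (theta_cube_lt_one hy) (pwbLaw_le_geom_cube hy1)
    (fun ρ hρ M => pwbAmp_mul_pow_unbounded hy0 hρ M)

/-- **Finite mean wall-renewal time for `y > μ³`**: `m(y) = Σ_s s f_s(y) < ∞`.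
[cite: MadrasSlade1993, §4.2, Theorem 4.2.2(b) (pp. 91–92)] [cite: Feller1968, XIII.3] -/
theorem summable_mul_pwbLaw_of_cube_lt (hy : hexConnectiveConstant ^ 3 < y) :
    Summable fun s : ℕ => (s : ℝ) * pwbLaw y s := by
  have hy1 := one_le_of_mu_cube_lt hy
  have hy0 : 0 < y := by linarith
  exact Literature.Probability.Process.Renewal.summable_mul_f_of_envelope (pwbLaw_nonneg hy0.le) (theta_cube_pos hy0)
    (theta_cube_lt_one hy) (pwbLaw_le_geom_cube hy1)

/-- **The renewal theorem for adsorbed wall bridges down to `y > μ³`**: `PWB_{2s}(y)/β(y)^{2s} → 1/m(y)` — pure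
exponential growth of positive wall bridges, now on `y > (2+√2)^{3/2}`. NEW (range extension of the tree's
`tendsto_pwbAmp`). [cite: MadrasSlade1993, §4.2, Theorem 4.2.2(b) (pp. 91–92)]
[cite: Feller1968, XIII.3, Theorem 3 (renewal theorem) and Ch. XIII §11] -/
theorem tendsto_pwbAmp_of_cube_lt (hy : hexConnectiveConstant ^ 3 < y) :
    Tendsto (pwbAmp y) atTop (𝓝 (pwbMean y)⁻¹) := by
  have hy1 := one_le_of_mu_cube_lt hy
  have hy0 : 0 < y := by linarith
  exact Literature.Probability.Process.Renewal.tendsto_of_summable_mul pwbAmp_zero (pwbAmp_nonneg hy0.le)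
    (pwbAmp_le_one hy0) (pwbLaw_nonneg hy0.le) pwbLaw_zero (fun n hn => pwbAmp_eq_sum hn) (hasSum_pwbLaw_of_cube_lt hy)
    (pwbLaw_one_pos hy0) (summable_mul_pwbLaw_of_cube_lt hy)

/-- `1 ≤ m(y)` for `y > μ³`. [cite: Feller1968, XIII.3] -/
theorem one_le_pwbMean_of_cube_lt (hy : hexConnectiveConstant ^ 3 < y) : 1 ≤ pwbMean y := by
  have hy1 := one_le_of_mu_cube_lt hy
  have hy0 : 0 < y := by linarith
  have hf1 := hasSum_pwbLaw_of_cube_lt hy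
  rw [pwbMean, ← hf1.tsum_eq]
  refine Summable.tsum_le_tsum (fun k => ?_) hf1.summable (summable_mul_pwbLaw_of_cube_lt hy)
  rcases Nat.eq_zero_or_pos k with h | h
  · subst h; simp [pwbLaw_zero]
  · exact le_mul_of_one_le_left (pwbLaw_nonneg hy0.le k) (by exact_mod_cast h)

/-- `0 < m(y)` for `y > μ³`. [cite: Feller1968, XIII.3] -/
theorem pwbMean_pos_of_cube_lt (hy : hexConnectiveConstant ^ 3 < y) : 0 < pwbMean y :=
  one_pos.trans_le (one_le_pwbMean_of_cube_lt hy)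

/-- **Two-sided bound for all `s`, `y > μ³`**: `(2 − m(y)) β^{2s} ≤ PWB_{2s}(y) ≤ β^{2s}`.
[cite: MadrasSlade1993, §4.2, Theorem 4.2.2(b) (pp. 91–92)] [cite: Feller1968, XIII.3, Theorem 3 and Ch. XIII §11] -/
theorem PWB_two_sided_of_cube_lt (hy : hexConnectiveConstant ^ 3 < y) (s : ℕ) :
    (2 - pwbMean y) * wallRate y ^ (2 * s) ≤ PWB (2 * s) y ∧ PWB (2 * s) y ≤ wallRate y ^ (2 * s) := by
  have hy1 := one_le_of_mu_cube_lt hy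
  have hy0 : 0 < y := by linarith
  have hB : 0 < wallRate y ^ (2 * s) := pow_pos (wallRate_pos y) _
  refine ⟨?_, PWB_le_pow hy0 s⟩
  have h := Zd.renewal_two_sub_tsum_le pwbAmp_zero (pwbAmp_le_one hy0) (pwbLaw_nonneg hy0.le) pwbLaw_zero
    (fun n hn => pwbAmp_eq_sum hn) (hasSum_pwbLaw_of_cube_lt hy) (summable_mul_pwbLaw_of_cube_lt hy) s
  change 2 - pwbMean y ≤ PWB (2 * s) y / wallRate y ^ (2 * s) at h
  rwa [le_div_iff₀ hB] at h

/-- `(2 − m(y)) β^{2s} ≤ WB_{2s}(y)` for every `s`, `y > μ³`. [cite: MadrasSlade1993, §4.2, Theorem 4.2.2(b) (pp. 91–92)]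
[cite: HammersleyTorrieWhittington1982, §2] -/
theorem two_sub_pwbMean_mul_pow_le_WB_of_cube_lt (hy : hexConnectiveConstant ^ 3 < y) (s : ℕ) :
    (2 - pwbMean y) * wallRate y ^ (2 * s) ≤ WB (2 * s) y := by
  have hy1 := one_le_of_mu_cube_lt hy
  exact (PWB_two_sided_of_cube_lt hy s).1.trans (PWB_le_WB _ (by linarith))

/-- **Explicit geometric rate for `y > μ³`** (in `_of` form). [cite: Feller1968, Ch. XIII §11 (proof of the renewal theorem)]
[cite: MadrasSlade1993, §4.2, Theorem 4.2.2(b) (pp. 91–92)] -/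
theorem abs_pwbAmp_sub_inv_pwbMean_le_of_cube_lt (hy : hexConnectiveConstant ^ 3 < y) {ρ G H : ℝ} (hρ : 1 ≤ ρ)
    (hG : HasSum (fun j : ℕ => (1 - ∑ k ∈ range (j + 2), pwbLaw y k) * ρ ^ (j + 1)) G) (hG1 : G < 1)
    (hH : HasSum (fun j : ℕ => (1 - ∑ k ∈ range (j + 2), pwbLaw y k) * ∑ l ∈ range (j + 1), ρ ^ l) H) (s : ℕ) :
    |pwbAmp y s - (pwbMean y)⁻¹| ≤ H / (pwbMean y * (1 - G)) * ρ⁻¹ ^ s := by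
  have hy1 := one_le_of_mu_cube_lt hy
  have hy0 : 0 < y := by linarith
  exact Literature.Probability.Process.Renewal.abs_sub_inv_tsum_le pwbAmp_zero (pwbLaw_nonneg hy0.le) pwbLaw_zero
    (fun n hn => pwbAmp_eq_sum hn) (hasSum_pwbLaw_of_cube_lt hy) (summable_mul_pwbLaw_of_cube_lt hy) hρ hG hG1 hH s

/-- For every `c < 1/m(y)`, `y > μ³`: eventually `c β^{2s} ≤ PWB_{2s}(y) ≤ WB_{2s}(y)`.
[cite: MadrasSlade1993, §4.2, Theorem 4.2.2(b) (pp. 91–92)] [cite: HammersleyTorrieWhittington1982, §2] -/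
theorem eventually_mul_pow_le_WB_of_lt_inv_pwbMean_of_cube_lt (hy : hexConnectiveConstant ^ 3 < y) {c : ℝ}
    (hc : c < (pwbMean y)⁻¹) : ∀ᶠ s : ℕ in atTop, c * wallRate y ^ (2 * s) ≤ PWB (2 * s) y ∧ PWB (2 * s) y ≤ WB (2 * s) y := by
  have hy1 := one_le_of_mu_cube_lt hy
  filter_upwards [(tendsto_pwbAmp_of_cube_lt hy).eventually (eventually_gt_nhds hc)] with s hs
  have hB : 0 < wallRate y ^ (2 * s) := pow_pos (wallRate_pos y) _
  exact ⟨((lt_div_iff₀ hB).1 hs).le, PWB_le_WB _ (by linarith)⟩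

/-- **Ratio limit for `y > μ³`**: `PWB_{2s+2}(y)/PWB_{2s}(y) → β(y)²`. [cite: MadrasSlade1993, §4.2, Theorem 4.2.2(b) (pp. 91–92)]
[cite: Feller1968, XIII.3, Theorem 3 (renewal theorem)] -/
theorem tendsto_PWB_ratio_of_cube_lt (hy : hexConnectiveConstant ^ 3 < y) :
    Tendsto (fun s : ℕ => PWB (2 * s + 2) y / PWB (2 * s) y) atTop (𝓝 (wallRate y ^ 2)) := by
  have hy1 := one_le_of_mu_cube_lt hy
  have hy0 : 0 < y := by linarith
  have hL : (pwbMean y)⁻¹ ≠ 0 := inv_ne_zero (pwbMean_pos_of_cube_lt hy).ne'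
  have h1 := (((tendsto_pwbAmp_of_cube_lt hy).comp (tendsto_add_atTop_nat 1)).div (tendsto_pwbAmp_of_cube_lt hy)
    hL).const_mul (wallRate y ^ 2)
  rw [div_self hL, mul_one] at h1
  refine h1.congr fun s => ?_
  have hP : PWB (2 * s) y ≠ 0 := (PWB_pos hy0 s).ne'
  have hβ : wallRate y ≠ 0 := (wallRate_pos y).ne'
  show wallRate y ^ 2 * (pwbAmp y (s + 1) / pwbAmp y s) = PWB (2 * s + 2) y / PWB (2 * s) y
  rw [pwbAmp, pwbAmp, show 2 * (s + 1) = 2 * s + 2 by ring]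
  field_simp
  ring

/-- **Explicit mean bound for `y > μ³`**: `m(y) ≤ 1 + C θ₃²/(1−θ₃)²` with `C = μ² + y^{2/3}/μ²`, `θ₃ = μ²/y^{2/3}` (from
`f_k ≤ C θ₃^k` and `Σ_{k ≥ 2} (k−1) θ₃^k = θ₃²/(1−θ₃)²`). [cite: Feller1968, XIII.3]
[cite: MadrasSlade1993, §4.2, remark before (4.2.21) (p. 94)] -/
theorem pwbMean_le_of_cube_lt (hy : hexConnectiveConstant ^ 3 < y) :
    pwbMean y ≤ 1 + (hexConnectiveConstant ^ 2 + y ^ ((2 : ℝ) / 3) / hexConnectiveConstant ^ 2) *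
      (hexConnectiveConstant ^ 2 / y ^ ((2 : ℝ) / 3) *
        (hexConnectiveConstant ^ 2 / y ^ ((2 : ℝ) / 3) / (1 - hexConnectiveConstant ^ 2 / y ^ ((2 : ℝ) / 3)) ^ 2)) := by
  have hy1 := one_le_of_mu_cube_lt hy
  have hy0 : 0 < y := by linarith
  set θ := hexConnectiveConstant ^ 2 / y ^ ((2 : ℝ) / 3) with hθ
  set C := hexConnectiveConstant ^ 2 + y ^ ((2 : ℝ) / 3) / hexConnectiveConstant ^ 2 with hC
  have hθ0 : 0 < θ := theta_cube_pos hy0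
  have hθ1 : θ < 1 := theta_cube_lt_one hy
  have hterm : ∀ k : ℕ, (k : ℝ) * pwbLaw y k ≤ pwbLaw y k + ((k - 1 : ℕ) : ℝ) * (C * θ ^ k) := by
    intro k
    rcases Nat.eq_zero_or_pos k with h | h
    · subst h; simp [pwbLaw_zero]
    · have hk : (k : ℝ) = 1 + ((k - 1 : ℕ) : ℝ) := by rw [Nat.cast_sub h, Nat.cast_one]; ring
      rw [hk, add_mul, one_mul]
      exact add_le_add le_rfl (mul_le_mul_of_nonneg_left (pwbLaw_le_geom_cube hy1 k) (Nat.cast_nonneg _))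
  have hθn : ‖θ‖ < 1 := by rw [Real.norm_eq_abs, abs_of_pos hθ0]; exact hθ1
  have h0 := (hasSum_coe_mul_geometric_of_norm_lt_one hθn).mul_left (C * θ)
  have h1 : HasSum (fun n : ℕ => (((n + 1 - 1 : ℕ) : ℝ)) * (C * θ ^ (n + 1))) (C * θ * (θ / (1 - θ) ^ 2)) := by
    have he : (fun n : ℕ => (((n + 1 - 1 : ℕ) : ℝ)) * (C * θ ^ (n + 1))) = fun i : ℕ => C * θ * ((i : ℝ) * θ ^ i) := by
      funext n
      simp only [Nat.add_sub_cancel, pow_succ]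
      ring
    rw [he]; exact h0
  have hF := (hasSum_nat_add_iff (f := fun k : ℕ => ((k - 1 : ℕ) : ℝ) * (C * θ ^ k)) 1).1 h1
  simp only [Finset.sum_range_one, Nat.zero_sub, Nat.cast_zero, zero_mul, add_zero] at hF
  have hsum := hasSum_le hterm (summable_mul_pwbLaw_of_cube_lt hy).hasSum ((hasSum_pwbLaw_of_cube_lt hy).add hF)
  calc pwbMean y ≤ 1 + C * θ * (θ / (1 - θ) ^ 2) := hsum
    _ = _ := by ring

end Literature.Probability.RandomPlanarGeometry.SAW.HexBW.Wall

end
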